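import Literature.AlgebraicGeometry.Deformation.SmoothSchemeLiftObstructionCriterionGluePullback
import Literature.AlgebraicGeometry.Deformation.FlatDeformationGluedIso
import Literature.AlgebraicGeometry.Deformation.SmoothSchemeLiftObstructionCriterionGlueLineBundle
import Literature.AlgebraicGeometry.Deformation.SmoothSchemeLiftObstructionCriterionGlueLineBundleBaseChange
import Literature.AlgebraicGeometry.Deformation.SmoothSchemeLiftObstructionCriterionGlueLineBundleConverse
import Literature.AlgebraicGeometry.Deformation.SmoothSchemeLiftObstructionCriterionGluedScheme
import Literature.AlgebraicGeometry.Deformation.FlatDeformationTransitionDataCover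
import Literature.AlgebraicGeometry.Deformation.LiftedGluingDataBaseChange
import Literature.AlgebraicGeometry.Deformation.PairLiftObstructionMove
import Literature.AlgebraicGeometry.Deformation.PairLiftTwistedCocycleObstructionCocycle
import Literature.AlgebraicGeometry.Deformation.PairLiftTwistedCocycleReduction
import Literature.AlgebraicGeometry.Deformation.PairLiftTwistedCocycleClosedFibre
import Literature.AlgebraicGeometry.Deformation.SmoothSchemeLiftObstructionCriterion
import Literature.AlgebraicGeometry.Deformation.CoefficientFieldAugmentation
import Literature.AlgebraicGeometry.AbelianSchemes.AbelianSchemeStructureOnLift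
import Literature.AlgebraicGeometry.AbelianSchemes.LDeltaRigidifiedFibrewiseAmple
import Literature.AlgebraicGeometry.AbelianSchemes.ArtinLocalFibreProjectiveCover
import Literature.AlgebraicGeometry.Morphisms.ProperOfSurjectiveComp
import Literature.AlgebraicGeometry.Morphisms.PrincipalAffineCoverWithFrames
import Literature.AlgebraicGeometry.Morphisms.PrincipalAffineCoverLiftFrames
import Literature.AlgebraicGeometry.Modules.CechPicOfLocalRing
import Literature.AlgebraicGeometry.Deformation.SmoothSchemeLiftObstructionCriterionGlueLineBundleClosedFibre
import Literature.AlgebraicGeometry.Deformation.SmoothSchemeLiftObstructionCriterionGlueLineBundleMovedLift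
import Literature.AlgebraicGeometry.AbelianSchemes.AbelianVarietyTangentCocycleOfCechTwoCocycle
import HarnessLib

/-!
# A line bundle lifts together with some lift of the abelian scheme — the G2 letter of the F-11 smoothness road
# ([MumfordFogartyKirwan1994] Ch. 6 §3 Prop. 6.15; [Oort1971] §2.3; [Hartshorne2010] Thm. 6.4 (a), Thm. 10.2)

Layer `Literature/AlgebraicGeometry/AbelianSchemes` (head in `AbelianSchemeOver`).  THEOREMS ONLY (no definition, no named fact, no instance,
no notation, no `sorry`).  Cell `hodgecm-mathlib` (D-0151), F-11 sub-line `F11SmoothRoadA` of crux stmt-HodgeConjecture-24835, α1 grandchild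
`Cruxes/HDel/Lines/F11LiftWithLineBundle.lean`, stub **G2** `stub_lineBundleLiftOfSomeLift` (G2-P letter e7db1ea7): the MONO-G2 composition
(integrator B-p13 (g22)) over the ★ bricks of F0P1b-p03∕p07∕p06∕p02, B-p04, B-p18, B-p21, B-typ03 — every input BY NAME, see the head.
**`AbelianSchemeOver.exists_lineBundleLift_of_lift`** = the G2-P letter (`IsLocalRing.`-qualified): for an Artin local `ℚ`-algebra `A` with a
coefficient field `k`, a principal small extension `A → A⧸(t)`, a polarised abelian scheme `(A₀, λ₀)` over `A⧸(t)` of relative dimension `g`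
and SOME abelian lift `X₁` of `A₀`, there is an abelian lift `X` of `A₀` with a rank-one `L` on `X`, rigidified along the unit section, and
`G^*L ≅ Gr₀^*𝒫₀ = L^Δ(λ₀)`.  Consumer: the Summits twin `Theorems/F11StubG2LineBundleLift.lean` (`stubG2_holds g`, F0P1c-p02 (g2)).
HC_CM is proved only modulo the 7 printed citations until rung 0 closes; this file asserts nothing about HC.

## References
* [MumfordFogartyKirwan1994] D. Mumford, J. Fogarty, F. Kirwan, *Geometric Invariant Theory*, 3rd ed. (1994), Ch. 6 §3 Proposition 6.15
  (p. 124) and its proof (p. 125); Ch. 6 §2 Definition 6.2–6.3 (p. 120), Proposition 6.10 (p. 121).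
* [Oort1971] F. Oort, *Finite group schemes, local moduli for abelian varieties, and lifting problems*, Compositio Math. 23 (1971), §2.3.
* [Hartshorne2010] R. Hartshorne, *Deformation Theory*, GTM 257 (2010): Thm. 6.4 (a) and proof (pp. 50–51), Thm. 10.2 (a) and proof (p. 81).
* [MumfordAV1970] D. Mumford, *Abelian Varieties* (1970), §13 (p. 123).
-/

noncomputable section

-- `TopCat.Presheaf`/`TopCat.Sheaf`/`Scheme.Modules` are not reducible (as in every ★ file of this chain).
set_option backward.isDefEq.respectTransparency false

open CategoryTheory CategoryTheory.Limits AlgebraicGeometry Opposite TopologicalSpace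
open scoped TensorProduct


namespace Literature.AlgebraicGeometry.AbelianSchemes

open Literature.AlgebraicGeometry.Motives Literature.AlgebraicGeometry.Modules
  Literature.AlgebraicGeometry.Morphisms Literature.AlgebraicGeometry.HodgeTheory
  Literature.AlgebraicGeometry.Deformation

/-! ## The composition -/

set_option maxHeartbeats 800000 in
/-- **A LINE BUNDLE LIFTS TOGETHER WITH SOME LIFT OF THE ABELIAN SCHEME** ([MumfordFogartyKirwan1994] Prop. 6.15 with [Oort1971] §2.3 ∕
[Hartshorne2010] Thm. 6.4 (a) + Thm. 10.2; the G2-P letter, principal small extension, arbitrary residue field).  `A` Artin local `ℚ`-algebra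
with coefficient field `k`, `t ∈ 𝔪_A`, `t ≠ 0`, `𝔪_A·t = 0`; `A₀` abelian over `A⧸(t)` of relative dimension `g` with a polarisation (graph `Gr₀`);
`X₁` SOME abelian lift.  THEN an abelian lift `X` of `A₀` (in general ANOTHER one: `X = Glue_A(u·ψ)`, the gluing data `ψ` of `X₁` moved by the
tangent cocycle `u = θ_D` killing the obstruction of the pair) carries a RANK-ONE `L`, rigidified, restricting to `L^Δ(λ₀) = Gr₀^*𝒫₀` on `A₀`.
Steps: (0) augmentation + coefficient line (★ `CoefficientFieldAugmentation`); (1) closed fibre `Xs`; (2′) `A₀` projective (★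
`isProjective_of_polarization_quotient_span_singleton`), finite principal affine cover trivialising `L₀` (★), lifted to `X₁` with frames (★
`exists_principal_affine_cover_lift_with_frames_of_isPullback`); (3) transition data of `X₁` (★), `Glue_A(ψ) ≅ X₁` (★ `exists_glued_iso_of_transition`);
(4) reduction `ψ'` (★ `exists_baseChange_gluingData`), `Φ₁` cartesian (★), `eA₀ : A₀ ≅ Glue_{A⧸J}(ψ')`; (5) `M := eA₀.inv^*L₀` framed on the chart
images, closed-fibre map `c := p ≫ eA₀.hom` with its chart squares, `Ls := p^*L₀` nondegenerate (★ B10), closed-fibre frames (★ S-cf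
`appLE_closedFibre_overlapSection`); (6) ★ LB-A `exists_pairLiftData_of_frames`; (7) ★ (I1) `exists_tangentCocycle_of_cechTwoCocycle` + ★ LB-B
`exists_movedLift_rankOne_pullback_iso`; (8) `Φ₂` cartesian, `G := eA₀.hom ≫ Φ₂`; (9) smooth (★), proper (★), abelian of rel. dim `g` (★
`exists_abelianSchemeOver_of_isPullback`); (10) assembly + ★ `CechPic.pullback_eq_one_of_isLocalRing`.
[cite: MumfordFogartyKirwan1994, Ch. 6 §3 Proposition 6.15 (p. 124) and its proof (p. 125)] [cite: Oort1971, §2.3]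
[cite: Hartshorne2010, Thm. 6.4 (a) and proof (pp. 50–51); Thm. 10.2 (a) and proof (p. 81)] [cite: MumfordAV1970, §13 (p. 123)] -/
theorem AbelianSchemeOver.exists_lineBundleLift_of_lift (g : ℕ) :
    ∀ (A : Type) [CommRing A] [Algebra ℚ A] [IsArtinianRing A] [IsLocalRing A]
      (k : Type) [Field k] [Algebra k A], Function.Surjective (⇑(IsLocalRing.residue A) ∘ ⇑(algebraMap k A)) →
      ∀ (t : A), t ≠ 0 → t ∈ IsLocalRing.maximalIdeal A → IsLocalRing.maximalIdeal A * Ideal.span {t} = ⊥ →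
      ∀ (A₀ : AbelianSchemeOver (Spec (.of (A ⧸ Ideal.span {t})))) (_ : A₀.IsOfRelDim g) (D₀ : A₀.DualPair)
        (pol₀ : A₀.Polarization D₀)
        (Gr₀ : A₀.X.left ⟶ A₀.prodLeft D₀.hat) (_ : Gr₀ ≫ pullback.fst A₀.X.hom D₀.hat.X.hom = 𝟙 _)
        (_ : Gr₀ ≫ pullback.snd A₀.X.hom D₀.hat.X.hom = pol₀.lam.left)
        (X₁ : AbelianSchemeOver (Spec (.of A))) (G₁ : A₀.X.left ⟶ X₁.X.left),
        A₀.IsBaseChangeVia X₁ (Spec.map (CommRingCat.ofHom (Ideal.Quotient.mk (Ideal.span {t})))) G₁ →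
        ∃ (X : AbelianSchemeOver (Spec (.of A))) (_ : X.IsOfRelDim g) (G : A₀.X.left ⟶ X.X.left)
          (_ : A₀.IsBaseChangeVia X (Spec.map (CommRingCat.ofHom (Ideal.Quotient.mk (Ideal.span {t})))) G)
          (L : X.left.Modules) (hL : HasRank L 1)
          (_ : CechPic.pullback X.unitSection (detClass (HasRank.isFiniteLocallyFree' hL)) = 1),
          Nonempty ((Scheme.Modules.pullback G).obj L ≅ (Scheme.Modules.pullback Gr₀).obj D₀.P) := by
  intro A _ _ _ _ k _ _ hk t ht0 htm hmJ A₀ hA₀ D₀ pol₀ Gr₀ hGr₁ hGr₂ X₁ G₁ hG₁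
  -- (0) the principal small extension `J = (t)`: `J ≤ 𝔪`, `J ≠ ⊤`, `J² = 0`, `J𝔪 = 0`; augmentation `π`; `e : J ≃ k`
  have h𝔪nil : IsNilpotent (IsLocalRing.maximalIdeal A) := Literature.AlgebraicGeometry.Deformation.isNilpotent_maximalIdeal_of_isArtinianRing
  have hJle : Ideal.span {t} ≤ IsLocalRing.maximalIdeal A := (Ideal.span_singleton_le_iff_mem _).2 htm
  have hJne : Ideal.span ({t} : Set A) ≠ ⊤ := fun h =>
    (IsLocalRing.maximalIdeal.isMaximal A).ne_top (top_le_iff.1 (h ▸ hJle))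
  have hJJ : Ideal.span {t} * Ideal.span ({t} : Set A) = ⊥ := le_bot_iff.1 ((Ideal.mul_mono_left hJle).trans hmJ.le)
  have hJ𝔪 : Ideal.span {t} * IsLocalRing.maximalIdeal A = ⊥ := by rw [mul_comm]; exact hmJ
  obtain ⟨π, hπ⟩ := exists_augmentation_of_coefficientField hk
  obtain ⟨eJ, heJ⟩ := exists_linearEquiv_span_singleton_symm_one hk t ht0 hmJ
  have hπJ : ∀ a ∈ Ideal.span ({t} : Set A), π a = 0 := fun a ha => by
    have h1 : a ∈ RingHom.ker π.toRingHom := hπ ▸ hJle ha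
    exact h1
  have hπnil : IsNilpotent (RingHom.ker π.toRingHom) := by rw [hπ]; exact h𝔪nil
  -- (1) the closed fibre `Xs := A₀ ×_{A⧸J} Spec k`, an abelian scheme over `Spec k`, inside `X₁` over `Spec π`
  let πq : A ⧸ Ideal.span {t} →ₐ[k] k := Ideal.Quotient.liftₐ (Ideal.span {t}) π hπJ
  have hπq : πq.toRingHom.comp (Ideal.Quotient.mk (Ideal.span {t})) = π.toRingHom :=
    RingHom.ext fun a => Ideal.Quotient.lift_mk (Ideal.span {t}) π.toRingHom hπJ
  let sk : Spec (CommRingCat.of k) ⟶ Spec (CommRingCat.of (A ⧸ Ideal.span {t})) := Spec.map (CommRingCat.ofHom πq.toRingHom)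
  have hsk : sk ≫ Spec.map (CommRingCat.ofHom (Ideal.Quotient.mk (Ideal.span {t}))) =
      Spec.map (CommRingCat.ofHom π.toRingHom) := by
    rw [← Spec.map_comp, ← CommRingCat.ofHom_comp, hπq]
  let Xs : AbelianSchemeOver (Spec (.of k)) := A₀.baseChange sk
  let p : Xs.X.left ⟶ A₀.X.left := pullback.fst A₀.X.hom sk
  have hp : IsPullback p Xs.X.hom A₀.X.hom sk := IsPullback.of_hasPullback A₀.X.hom sk
  obtain ⟨w₁, hpb₁, hη₁, hμ₁⟩ := hG₁
  have hi : IsPullback (p ≫ G₁) Xs.X.hom X₁.X.hom (Spec.map (CommRingCat.ofHom π.toRingHom)) := by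
    rw [← hsk]; exact hp.paste_horiz hpb₁
  -- the K1 structures (`k` on the closed fibre, `A` upstairs), `halg`/`halgA` by `rfl`
  letI instΓk : ∀ W : Xs.X.left.Opens, Algebra k Γ(Xs.X.left, W) := fun W =>
    ((constToPresheaf Xs.X).app (op W)).hom.toAlgebra
  have halg : ∀ (W : Xs.X.left.Opens) (s : k),
      algebraMap k Γ(Xs.X.left, W) s = (constToPresheaf Xs.X).app (op W) s := fun _ _ => rfl
  letI instΓA : ∀ W : X₁.X.left.Opens, Algebra A Γ(X₁.X.left, W) := fun W =>
    ((constToPresheaf X₁.X).app (op W)).hom.toAlgebra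
  have halgA : ∀ (W : X₁.X.left.Opens) (a : A),
      algebraMap A Γ(X₁.X.left, W) a = (constToPresheaf X₁.X).app (op W) a := fun _ _ => rfl
  haveI : Smooth Xs.X.hom := Xs.isSmooth
  haveI : Smooth X₁.X.hom := X₁.isSmooth
  haveI : IsProper A₀.X.hom := A₀.isProper

  -- (2′) FRAMES FROM `A₀` (F0P1b-p07's currency): `L₀ := Gr₀^*𝒫₀` of rank one; `A₀ → Spec (A⧸J)` is projective (★ p797210);
  -- a finite principal affine cover of `A₀` with rank-one frames of `L₀` (★ p796811), lifted to `X₁` keeping frames (★ p796148);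
  -- the closed-fibre cover is its preimage under `p ≫ G₁`.
  let L₀ : A₀.X.left.Modules := (Scheme.Modules.pullback Gr₀).obj D₀.P
  have hL₀ : HasRank L₀ 1 := hasRank_pullback Gr₀ D₀.hasRank_one
  have hproj : Morphisms.IsProjective A₀.X.hom :=
    AbelianSchemeOver.isProjective_of_polarization_quotient_span_singleton A t htm A₀ D₀ pol₀ Gr₀ hGr₁ hGr₂
  obtain ⟨ι, hιfin, U₀, b₀, hb₀, hU₀cov, ⟨t₀⟩⟩ :=
    exists_finite_principal_affine_cover_iframes_of_isProjective hproj L₀ hL₀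
  have hmk_surj : Function.Surjective (Ideal.Quotient.mk (Ideal.span ({t} : Set A))) := Ideal.Quotient.mk_surjective
  have hmk_nil : IsNilpotent (RingHom.ker (Ideal.Quotient.mk (Ideal.span ({t} : Set A)))) := by
    rw [Ideal.mk_ker]; exact ⟨2, by rw [pow_two, hJJ]; rfl⟩
  obtain ⟨U', b', hU', hb', hU'cov, ht⟩ := exists_principal_affine_cover_lift_with_frames_of_isPullback
    (Ideal.Quotient.mk (Ideal.span {t})) hmk_surj hmk_nil hpb₁ U₀ b₀ hb₀ hU₀cov (fun j => (U₀ j).1) t₀.frame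
    (fun j => ⟨j, le_rfl⟩)
  -- frames of `L₀` on `G₁⁻¹ U' j`
  let tfr : ∀ j, SheafOfModules.free (PUnit : Type) ≅ L₀.over (G₁ ⁻¹ᵁ (U' j).1) := fun j => (ht j).some
  -- the closed-fibre cover `U j := (p ≫ G₁)⁻¹ (U' j)`
  let U : ι → Xs.X.left.affineOpens := fun j =>
    ⟨(p ≫ G₁) ⁻¹ᵁ (U' j).1, isAffineOpen_preimage_closedFibre π (p ≫ G₁) hi (U' j).2⟩
  let bU : (j l : ι) → Γ(Xs.X.left, (U j).1) := fun j l => (p ≫ G₁).app (U' j).1 (b' j l)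
  have hbU : ∀ j l, (U j).1 ⊓ (U l).1 = Xs.X.left.basicOpen (bU j l) := fun j l =>
    inf_preimage_eq_basicOpen (p ≫ G₁) (b' j l) (hb' j l)
  have hU : ∀ j, (U j).1 = (p ≫ G₁) ⁻¹ᵁ (U' j).1 := fun j => rfl
  have hUcov : ⨆ j, (U j).1 = ⊤ := by
    change ⨆ j, (p ≫ G₁) ⁻¹ᵁ (U' j).1 = ⊤
    rw [← Scheme.Hom.preimage_iSup, hU'cov]; rfl
  -- (3) the transition data of `X₁` on the lifted cover (★ c2b) and the glued presentation (PASTE c2c)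
  haveI : Flat X₁.X.hom := inferInstance
  obtain ⟨e₁, ε₁, ε₂, he₁, hε₁, hε₂, -, -, hψ, hcoc⟩ :=
    exists_transition_data_of_cover π halg halgA (p ≫ G₁) hi U' b' hb' U hU
  -- the nilpotent ideal of coefficients and the glued presentation `Ψ : Glue_A(ψ) ≅ X₁` (PASTE c2c)
  have hUcov' : IsOpenCover fun j => (U' j).1 := IsOpenCover.mk hU'cov
  have h𝔫A : IsNilpotent (RingHom.ker π) := hπnil
  obtain ⟨q₁, hq₁, -⟩ := existsUnique_structureMap halg A U bU hbU (fun j l => SmoothAffineDeformation.transition (ε₁ j l) (ε₂ j l))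
    (RingHom.ker π) h𝔫A hψ hcoc
  obtain ⟨Ψ, hΨι, hΨiso, hΨq⟩ := exists_glued_iso_of_transition π halg halgA (p ≫ G₁) U' b' hb' U hU bU hbU e₁ he₁
    ε₁ ε₂ hε₁ hε₂ (RingHom.ker π) h𝔫A hπnil hUcov' hψ hcoc q₁ hq₁
  -- (4) reduction along `σ := A → A⧸J` (brick B5) and the cartesian square `Φ₁ : Glue_{A⧸J}(ψ') → Glue_A(ψ)` (PASTE S5)
  let σ : A →ₐ[k] A ⧸ Ideal.span {t} := Ideal.Quotient.mkₐ k (Ideal.span {t})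
  have hσsurj : Function.Surjective σ := Ideal.Quotient.mkₐ_surjective k _
  obtain ⟨ψ', hψ', hcoc', hψσ⟩ := exists_baseChange_gluingData halg σ U bU hbU
    (fun j l => SmoothAffineDeformation.transition (ε₁ j l) (ε₂ j l)) (RingHom.ker π) h𝔫A ((RingHom.ker π).map σ)
    (fun n hn => Ideal.mem_map_of_mem _ hn) hψ hcoc
  have h𝔫' : IsNilpotent ((RingHom.ker π).map σ) := by
    obtain ⟨n, hn⟩ := h𝔫A; exact ⟨n, by rw [← Ideal.map_pow, hn, Ideal.zero_eq_bot, Ideal.map_bot]; rfl⟩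
  obtain ⟨q₁', hq₁', -⟩ := existsUnique_structureMap halg (A ⧸ Ideal.span {t}) U bU hbU ψ' _ h𝔫' hψ' hcoc'
  obtain ⟨Φ₁, hΦ₁ι, hΦ₁q, hΦ₁pb⟩ := exists_baseChangeMap_isPullback halg σ U bU hbU
    (fun j l => SmoothAffineDeformation.transition (ε₁ j l) (ε₂ j l)) ψ' (RingHom.ker π) h𝔫A _ h𝔫' hψ hψ' hcoc hcoc' hψσ q₁ hq₁ q₁' hq₁'
  -- `A₀ ≅ Glue_{A⧸J}(ψ')`: two pull-backs of the cospan (`q₁`, `Spec σ`) — transport `hG₁`'s square along `Ψ`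
  haveI := hΨiso
  have hσmk : Spec.map (CommRingCat.ofHom σ.toRingHom) =
      Spec.map (CommRingCat.ofHom (Ideal.Quotient.mk (Ideal.span {t}))) := rfl
  have hpbA₀ : IsPullback (G₁ ≫ inv Ψ) A₀.X.hom q₁ (Spec.map (CommRingCat.ofHom σ.toRingHom)) := by
    rw [hσmk]
    refine hpb₁.of_iso (Iso.refl _) (asIso Ψ).symm (Iso.refl _) (Iso.refl _) ?_ ?_ ?_ ?_
    · simp
    · simp
    · simp [← hΨq]
    · simp
  let eA₀ : A₀.X.left ≅ (deformationGlueDatum halg (A ⧸ Ideal.span {t}) U bU hbU ψ' _ h𝔫' hψ' hcoc').glueData.glued :=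
    hpbA₀.isoIsPullback _ _ hΦ₁pb
  have heA₀Φ : eA₀.hom ≫ Φ₁ = G₁ ≫ inv Ψ := hpbA₀.isoIsPullback_hom_fst _ _ hΦ₁pb
  have heA₀q : eA₀.hom ≫ q₁' = A₀.X.hom := hpbA₀.isoIsPullback_hom_snd _ _ hΦ₁pb

  -- (5′) THE FRAMED MODULE ON `Glue_{A⧸J}(ψ')`: `M := eA₀.inv^* L₀` with frames on the chart images (input of p07's LB-A)
  have hΦΨ : eA₀.inv ≫ G₁ = Φ₁ ≫ Ψ := by
    rw [Iso.inv_comp_eq, ← Category.assoc, heA₀Φ, Category.assoc, IsIso.inv_hom_id, Category.comp_id]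
  let M : (deformationGlueDatum halg (A ⧸ Ideal.span {t}) U bU hbU ψ' _ h𝔫' hψ' hcoc').glueData.glued.Modules :=
    (Scheme.Modules.pullback eA₀.inv).obj L₀
  have hM : HasRank M 1 := hasRank_pullback eA₀.inv hL₀
  have hVj : ∀ j, ((deformationGlueDatum halg (A ⧸ Ideal.span {t}) U bU hbU ψ' _ h𝔫' hψ' hcoc').glueData.ι j).opensRange ≤
      eA₀.inv ⁻¹ᵁ (G₁ ⁻¹ᵁ (U' j).1) := by
    intro j x hx
    have h1 := opensRange_le_preimage_baseChangeMap halg σ U bU hbU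
      (fun j l => SmoothAffineDeformation.transition (ε₁ j l) (ε₂ j l)) ψ' (RingHom.ker π) h𝔫A _ h𝔫'
      hψ hψ' hcoc hcoc' Φ₁ hΦ₁ι j hx
    rw [← preimage_gluedToDeformation_eq_opensRange (π := π) (halg := halg) (i := p ≫ G₁) (U' := U') (U := U)
      (hU := hU) (b := bU) (hb := hbU) (e := e₁) (he := he₁)
      (ψ := fun j l => SmoothAffineDeformation.transition (ε₁ j l) (ε₂ j l)) (𝔫 := RingHom.ker π) (h𝔫 := h𝔫A) (hψ := hψ)
      (hcoc := hcoc) hπnil Ψ hΨι j] at h1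
    change (eA₀.inv ≫ G₁) x ∈ ((U' j).1 : Set X₁.X.left)
    rw [hΦΨ]
    exact h1
  let fM : ∀ j, SheafOfModules.free (PUnit : Type) ≅
      M.over ((deformationGlueDatum halg (A ⧸ Ideal.span {t}) U bU hbU ψ' _ h𝔫' hψ' hcoc').glueData.ι j).opensRange :=
    fun j => SheafOfModules.restrictTrivialisation
      (R := (deformationGlueDatum halg (A ⧸ Ideal.span {t}) U bU hbU ψ' _ h𝔫' hψ' hcoc').glueData.glued.ringCatSheaf)
      (homOfLE (hVj j)) (pullbackFrame eA₀.inv (tfr j))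
  -- (5″) BETWEEN, part 1 (B-p13): the CLOSED-FIBRE MAP `c := p ≫ eA₀.hom : Xs ⟶ Glue_{A⧸J}(ψ')` and its CHART SQUARES
  -- `chartProj k U j ≫ c = Spec (πq ⊗ 1) ≫ ι' j` (from c2b's `he₁`, c2c's `hΨι`, S5's `hΦ₁ι`, `heA₀Φ`, `Φ₁` mono).
  have hπqσ : ∀ a, πq (σ a) = π a := fun a => Ideal.Quotient.lift_mk (Ideal.span {t}) π.toRingHom hπJ
  have hmapπ : ∀ j, (Algebra.TensorProduct.map πq (AlgHom.id k Γ(Xs.X.left, (U j).1))).toRingHom.comp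
      (Algebra.TensorProduct.map σ (AlgHom.id k Γ(Xs.X.left, (U j).1))).toRingHom =
      (Algebra.TensorProduct.map π (AlgHom.id k Γ(Xs.X.left, (U j).1))).toRingHom := by
    intro j
    refine RingHom.ext fun x => ?_
    induction x using TensorProduct.induction_on with
    | zero => simp
    | tmul a c =>
      rw [RingHom.comp_apply, AlgHom.toRingHom_eq_coe, AlgHom.toRingHom_eq_coe, AlgHom.toRingHom_eq_coe, RingHom.coe_coe,
        RingHom.coe_coe, RingHom.coe_coe, Algebra.TensorProduct.map_tmul, Algebra.TensorProduct.map_tmul,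
        Algebra.TensorProduct.map_tmul, hπqσ]
      rfl
    | add x y hx hy => rw [map_add, map_add, hx, hy]
  have hsf : ∀ j (x : A ⊗[k] Γ(Xs.X.left, (U j).1)),
      (Algebra.TensorProduct.map π (AlgHom.id k Γ(Xs.X.left, (U j).1))) x =
        (1 : k) ⊗ₜ (SmoothAffineDeformation.specialFibreHom π _ x) := by
    intro j x
    induction x using TensorProduct.induction_on with
    | zero => simp
    | tmul a c =>
      rw [Algebra.TensorProduct.map_tmul, SmoothAffineDeformation.specialFibreHom_tmul, AlgHom.id_apply,
        TensorProduct.tmul_smul, TensorProduct.smul_tmul', Algebra.smul_def, mul_one, Algebra.algebraMap_self,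
        RingHom.id_apply]
    | add x y hx hy => rw [map_add, map_add, hx, hy, TensorProduct.tmul_add]
  haveI hΦ₁CI : IsClosedImmersion Φ₁ :=
    MorphismProperty.of_isPullback hΦ₁pb.flip (IsClosedImmersion.spec_of_surjective _ hσsurj)
  have hc : ∀ j, chartProj k U j ≫ (p ≫ eA₀.hom) =
      Spec.map (CommRingCat.ofHom (Algebra.TensorProduct.map πq (AlgHom.id k Γ(Xs.X.left, (U j).1))).toRingHom) ≫
        (deformationGlueDatum halg (A ⧸ Ideal.span {t}) U bU hbU ψ' _ h𝔫' hψ' hcoc').glueData.ι j := by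
    intro j
    rw [← cancel_mono Φ₁, Category.assoc, Category.assoc, Category.assoc, heA₀Φ, hΦ₁ι j, ← Spec.map_comp_assoc,
      ← CommRingCat.ofHom_comp, hmapπ j, ← Category.assoc, ← Category.assoc, IsIso.comp_inv_eq]
    simp only [Category.assoc]
    rw [hΨι j, chartProj_eq, Category.assoc, ← IsAffineOpen.SpecMap_appLE_fromSpec (p ≫ G₁) (U' j).2 (U j).2 (hU j).le,
      ← Spec.map_comp_assoc, ← Spec.map_comp_assoc]
    congr 2
    apply CommRingCat.hom_ext
    refine RingHom.ext fun y => ?_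
    obtain ⟨x, rfl⟩ := (e₁ j).surjective y
    change (Algebra.TensorProduct.includeRight (R := k) (A := k) (B := Γ(Xs.X.left, (U j).1)))
        ((p ≫ G₁).appLE (U' j).1 (U j).1 (hU j).le (e₁ j x)) =
      (Algebra.TensorProduct.map π (AlgHom.id k Γ(Xs.X.left, (U j).1))) ((e₁ j).symm (e₁ j x))
    rw [he₁ j x, AlgEquiv.symm_apply_apply, hsf]
    rfl
  have hUc : ∀ j, (U j).1 ≤ (p ≫ eA₀.hom) ⁻¹ᵁ
      ((deformationGlueDatum halg (A ⧸ Ideal.span {t}) U bU hbU ψ' _ h𝔫' hψ' hcoc').glueData.ι j).opensRange := by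
    intro j x hx
    have hx' : x ∈ Set.range (chartProj k U j) := by rw [range_chartProj_field]; exact hx
    obtain ⟨y, rfl⟩ := hx'
    change (chartProj k U j ≫ p ≫ eA₀.hom) y ∈
      ((deformationGlueDatum halg (A ⧸ Ideal.span {t}) U bU hbU ψ' _ h𝔫' hψ' hcoc').glueData.ι j).opensRange
    rw [hc j]
    exact ⟨_, rfl⟩
  -- the closed-fibre line bundle `Ls := p^*L₀ = L^Δ(λ₀)|_{Xs}` is NONDEGENERATE (★ B10 p796934) and is `c^*M`
  let Ls : Xs.X.left.Modules := (Scheme.Modules.pullback p).obj L₀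
  have hLs : HasRank Ls 1 := hasRank_pullback p hL₀
  obtain ⟨hεs, hΘs⟩ := pol₀.LDelta_baseChange_nondegenerate A₀ Gr₀ hGr₁ hGr₂ sk hLs
  let eLs : (Scheme.Modules.pullback (p ≫ eA₀.hom)).obj M ≅ Ls :=
    (Scheme.Modules.pullbackComp (p ≫ eA₀.hom) eA₀.inv).app L₀ ≪≫
      (Scheme.Modules.pullbackCongr (show (p ≫ eA₀.hom) ≫ eA₀.inv = p by simp)).app L₀
  -- the CLOSED-FIBRE FRAMES of `Ls` cut from the frames `fM` of `M` on the chart images, and S-cf: their transition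
  -- functions are the closed-fibre readings `lid ((πq ⊗ 1) G0)` of any exact twisted cocycle `G0` reading the `fM` (LB-A's output)
  let Fc : IFrames ((Scheme.Modules.pullback (p ≫ eA₀.hom)).obj M) (fun j => (U j).1) :=
    ⟨fun j => SheafOfModules.restrictTrivialisation (R := Xs.X.left.ringCatSheaf) (homOfLE (hUc j))
      (pullbackFrame (p ≫ eA₀.hom) (fM j))⟩
  let Fs : IFrames Ls (fun j => (U j).1) := Fc.mapIso eLs
  have hFs : ∀ (G0 : (j l : ι) → (A ⧸ Ideal.span {t}) ⊗[k] Γ(Xs.X.left, (U j).1 ⊓ (U l).1))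
      (s0 : (j l : ι) → Γ((deformationGlueDatum halg (A ⧸ Ideal.span {t}) U bU hbU ψ' _ h𝔫' hψ' hcoc').glueData.glued,
        ((deformationGlueDatum halg (A ⧸ Ideal.span {t}) U bU hbU ψ' _ h𝔫' hψ' hcoc').glueData.ι j).opensRange ⊓
          ((deformationGlueDatum halg (A ⧸ Ideal.span {t}) U bU hbU ψ' _ h𝔫' hψ' hcoc').glueData.ι l).opensRange))
      (_ : ∀ j l, ((chartOverlap (A ⧸ Ideal.span {t}) U j l).ι ≫
          (deformationGlueDatum halg (A ⧸ Ideal.span {t}) U bU hbU ψ' _ h𝔫' hψ' hcoc').glueData.ι j).appLE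
          (((deformationGlueDatum halg (A ⧸ Ideal.span {t}) U bU hbU ψ' _ h𝔫' hψ' hcoc').glueData.ι j).opensRange ⊓
            ((deformationGlueDatum halg (A ⧸ Ideal.span {t}) U bU hbU ψ' _ h𝔫' hψ' hcoc').glueData.ι l).opensRange) ⊤
          (top_le_preimage_opensRange_inf halg (A ⧸ Ideal.span {t}) U bU hbU ψ' _ h𝔫' hψ' hcoc' j l) (s0 j l) =
        overlapRingHom halg (A ⧸ Ideal.span {t}) U j l (G0 j l))
      (_ : ∀ (j l : ι) (V : (deformationGlueDatum halg (A ⧸ Ideal.span {t}) U bU hbU ψ' _ h𝔫' hψ' hcoc').glueData.glued.Opens)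
        (hj : V ≤ ((deformationGlueDatum halg (A ⧸ Ideal.span {t}) U bU hbU ψ' _ h𝔫' hψ' hcoc').glueData.ι j).opensRange)
        (hl : V ≤ ((deformationGlueDatum halg (A ⧸ Ideal.span {t}) U bU hbU ψ' _ h𝔫' hψ' hcoc').glueData.ι l).opensRange),
        transition (fM j) (fM l) (homOfLE hj) (homOfLE hl) =
          Matrix.of fun _ _ => secRes (deformationGlueDatum halg (A ⧸ Ideal.span {t}) U bU hbU ψ' _ h𝔫' hψ' hcoc').glueData.glued
            (le_inf hj hl) (s0 j l)),
      ∀ j l, Fs.tf j l = Algebra.TensorProduct.lid k Γ(Xs.X.left, (U j).1 ⊓ (U l).1)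
        (Algebra.TensorProduct.map πq (AlgHom.id k Γ(Xs.X.left, (U j).1 ⊓ (U l).1)) (G0 j l)) := by
    intro G0 s0 hs0 hfM j l
    rw [IFrames.tf_mapIso, IFrames.tf, transitionDet_eq_of_subsingleton _ _ _ _ _ _ PUnit.unit PUnit.unit]
    change transition (SheafOfModules.restrictTrivialisation (R := Xs.X.left.ringCatSheaf) (homOfLE (hUc j))
        (pullbackFrame (p ≫ eA₀.hom) (fM j))) (SheafOfModules.restrictTrivialisation (R := Xs.X.left.ringCatSheaf)
        (homOfLE (hUc l)) (pullbackFrame (p ≫ eA₀.hom) (fM l))) (homOfLE inf_le_left) (homOfLE inf_le_right)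
        PUnit.unit PUnit.unit = _
    rw [transition_restrictTrivialisation, transition_pullbackFrame (p ≫ eA₀.hom) (fM j) (fM l)
      (inf_le_inf (hUc j) (hUc l)) (homOfLE inf_le_left ≫ homOfLE (hUc j)) (homOfLE inf_le_right ≫ homOfLE (hUc l)),
      hfM j l _ inf_le_left inf_le_right, Matrix.map_apply, Matrix.of_apply, secRes_self]
    exact appLE_closedFibre_overlapSection halg πq U bU hbU ψ' _ h𝔫' hψ' hcoc' (p ≫ eA₀.hom) hc G0 s0 hs0 j l _
  -- (6)(7) ★ LB-A ∘ BETWEEN (S-cf + (I1)) ∘ ★ LB-B (F0P1b-p07 (g0) p799900; (I1) F0P1b-p03 (g2))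
  -- LB-A (F0P1b-p07 (g0)): the pair-lift data of the framed module `(M, fM)`
  have hJ𝔫π : Ideal.span {t} * RingHom.ker π = ⊥ := by
    rw [show RingHom.ker π = RingHom.ker π.toRingHom from rfl, hπ]; exact hJ𝔪
  have hJleπ : Ideal.span {t} ≤ RingHom.ker π := by
    rw [show RingHom.ker π = RingHom.ker π.toRingHom from rfl, hπ]; exact hJle
  have h𝔫'πq : ∀ r ∈ (RingHom.ker π).map σ, πq r = 0 := by
    intro r hr
    obtain ⟨a, ha, rfl⟩ := (Ideal.mem_map_iff_of_surjective σ hσsurj).1 hr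
    rw [hπqσ]; exact ha
  obtain ⟨G₀, s₀, G, g, -, s, -, hs₀, -, hfM, hGσ, hgdef, -, -, hG, hgcoc, hs, hs4⟩ :=
    exists_pairLiftData_of_frames halg σ hσsurj U bU hbU _ ψ' (RingHom.ker π) h𝔫A _ h𝔫' hψ hψ' hcoc hcoc' hψσ
      (Ideal.span {t}) (fun _ => Ideal.Quotient.eq_zero_iff_mem) hJJ hJ𝔫π eJ π πq hπqσ h𝔫'πq (fun _ h => h) M fM
  -- BETWEEN (B-p13): S-cf — the closed-fibre frames of `Ls` read the lifts: `Fs.tf = g`, `Fs.tfOn⁻¹ = g⁻¹`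
  have hgF : ∀ l m, Fs.tf l m = g l m := fun l m => (hFs G₀ s₀ hs₀ hfM l m).trans (hgdef l m).symm
  have hgi' : ∀ l m, g l m * Fs.tfOn m l ((U l).1 ⊓ (U m).1) inf_le_right inf_le_left = 1 := by
    intro l m
    rw [← hgF, IFrames.tf_eq_tfOn, IFrames.tfOn_mul, IFrames.tfOn_self]
  -- BETWEEN: SOCKET (I1) on the closed fibre `(Xs, Ls)` with the ★ B10 nondegeneracy and the closed-fibre frames `Fs`
  haveI : CharZero k := charZero_of_coefficientField (A := A)
  obtain ⟨θ, hθcoc, h, hsh⟩ := Xs.exists_tangentCocycle_of_cechTwoCocycle hLs hεs hΘs U hUcov Fs s hs4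
  have hsh' := fun j l m => by have e := hsh j l m; rw [hgF] at e; exact e
  -- LB-B: the moved lift `ψ₂ := u·ψ`, its rank-one module `L₂` and the prescribed restriction `Φ^*L₂ ≅ M`
  obtain ⟨u, -, hψ₂, hcoc₂, L₂, hL₂, hψσ₂, hLiso⟩ :=
    exists_movedLift_rankOne_pullback_iso halg σ hσsurj U bU hbU _ ψ' (RingHom.ker π) h𝔫A _ h𝔫' hψ hψ' hcoc hcoc'
      hψσ (Ideal.span {t}) (fun _ => Ideal.Quotient.eq_zero_iff_mem) hJJ hJ𝔫π hJleπ eJ M fM G₀ s₀ hs₀ hfM G hGσ g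
      (fun l m => Fs.tfOn m l ((U l).1 ⊓ (U m).1) inf_le_right inf_le_left) hgi' hG hgcoc s hs θ hθcoc h hsh'
  -- (8) the moved glued deformation `X' := Glue_A(ψ₂)` over `Spec A`, its reduction `Φ₂ : Glue_{A⧸J}(ψ') ⟶ X'` (★ S5), and
  -- `G := eA₀.hom ≫ Φ₂`, cartesian over `Spec (A → A⧸J)`
  obtain ⟨q₂, hq₂, -⟩ := existsUnique_structureMap halg A U bU hbU
    (fun j l => u j l * SmoothAffineDeformation.transition (ε₁ j l) (ε₂ j l)) (RingHom.ker π) h𝔫A hψ₂ hcoc₂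
  obtain ⟨Φ₂, hΦ₂ι, hΦ₂q, hΦ₂pb⟩ := exists_baseChangeMap_isPullback halg σ U bU hbU
    (fun j l => u j l * SmoothAffineDeformation.transition (ε₁ j l) (ε₂ j l)) ψ' (RingHom.ker π) h𝔫A _ h𝔫'
    hψ₂ hψ' hcoc₂ hcoc' hψσ₂ q₂ hq₂ q₁' hq₁'
  obtain ⟨eL⟩ := hLiso Φ₂ hΦ₂ι
  have hGpb : IsPullback (eA₀.hom ≫ Φ₂) A₀.X.hom q₂
      (Spec.map (CommRingCat.ofHom (Ideal.Quotient.mk (Ideal.span {t})))) := by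
    rw [← hσmk]
    refine hΦ₂pb.of_iso eA₀.symm (Iso.refl _) (Iso.refl _) (Iso.refl _) ?_ ?_ ?_ ?_
    · simp
    · simp [← heA₀q]
    · simp
    · simp
  -- (9) `X' → Spec A` is smooth (★) and proper (★, thickening of the proper `A₀`), hence an abelian scheme of relative
  -- dimension `g` of which `A₀` is the base change (★ p796069, [MFK94] Prop. 6.15)
  let X₂ : Over (Spec (CommRingCat.of A)) := Over.mk q₂
  haveI hsm : Smooth X₂.hom := smooth_structureMap halg A U bU hbU
    (fun j l => u j l * SmoothAffineDeformation.transition (ε₁ j l) (ε₂ j l)) (RingHom.ker π) h𝔫A hψ₂ hcoc₂ q₂ hq₂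
  haveI : LocallyOfFiniteType X₂.hom := inferInstance
  haveI hpr : IsProper X₂.hom :=
    isProper_of_isPullback_specMap_quotientMk_of_ne_top (q := X₂.hom) hJne hGpb
  obtain ⟨GX, hgc, hdim, hbc⟩ :=
    AbelianSchemeOver.exists_abelianSchemeOver_of_isPullback (X := X₂) (G := eA₀.hom ≫ Φ₂) hJne hmJ hGpb hA₀
  -- (10) assembly: `L := L₂`, rigidification free over the local `A` (★), `G^*L₂ ≅ eA₀.hom^* Φ₂^* L₂ ≅ eA₀.hom^* eA₀.inv^* L₀ ≅ L₀`
  refine ⟨@AbelianSchemeOver.mk _ X₂ GX hpr hsm hgc, hdim, eA₀.hom ≫ Φ₂, hbc, L₂, hL₂,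
    CechPic.pullback_eq_one_of_isLocalRing _ _, ⟨?_⟩⟩
  exact ((Scheme.Modules.pullbackComp eA₀.hom Φ₂).app L₂).symm ≪≫ (Scheme.Modules.pullback eA₀.hom).mapIso eL ≪≫
    (Scheme.Modules.pullbackComp eA₀.hom eA₀.inv).app L₀ ≪≫ (Scheme.Modules.pullbackCongr eA₀.hom_inv_id).app L₀ ≪≫
    (Scheme.Modules.pullbackId _).app L₀

end Literature.AlgebraicGeometry.AbelianSchemes

end
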